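import Literature.Topology.FourManifolds.SegThree
import Literature.Topology.FourManifolds.FrameC
import Literature.Topology.FourManifolds.TwistOut
import HarnessLib

/-!
# The host of the transported frame is the reflected twisted output of the third conjugation

Topic `Literature/Topology/FourManifolds` (trunk T-4MAN). Fact seat
`provefact-Literature.Topology.FourManifolds.Knot.IsConnectedSum.isIsotopic` (Schubert's theorem),
geometric heart for rail knots. Data: the flip pairs `(b, c)` and `(c', b')` at flat scales
(`Hb`, `H₁` : `FlatHost.FlatHyp`), the rail reference `Hb.hostHyp` of `b`, one unit scale for
both the first (`SegOne.lean`, `FrameC.lean`) and the third (`SegThree.lean`) segment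
conjugation, and the twist of the third output by the linearisation `L₁` of the first
(`TwistOut.lean`): `T₃ = outTw`.

* `hostC`: the host of `c'` over the transported frame `frameC` of `FrameC.lean`.
* `hostC_circlePt_chordLift`: **`hostC (circlePt (ĝ t)) = R (T₃ (circlePt t))`** for every `t`:
  off the content of `b` both are the host of the flip frame of `(c', b')` at `u = 1` (hosts of
  `c'` over two wall frames agree on the content of `c'`, `WallHost.hostLoop_congr_of_mem`, and
  off it the transported frame is the flip frame, `FrameC.frameC_eq_periodise`); on the content of
  `b` both are the first output `P₁` (same unit re-inserted by the same affine map on the window,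
  same segment and spiral points carried to the same chord points off it).
* `isIsotopic_hostC`: hence `hostC ≃ R ∘ T₃ ≃ R ∘ outThree ≃ R ∘ B`.

Everything is proved; no named facts are introduced.

## References

* M. W. Hirsch, *Differential Topology*, GTM 33 (1976), Ch. 8 §1, Thm. 1.3. [HirschDT1976]
-/

open scoped Manifold ContDiff Topology Real
open Function Set Metric Filter

noncomputable section

namespace Literature.Topology.FourManifolds

/-- Local notation: `𝔼 n` is the model Euclidean space `EuclideanSpace ℝ (Fin n)`. -/
local notation "𝔼 " n:arg => EuclideanSpace ℝ (Fin n)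

/-- Local notation: `𝕊 n` is the unit sphere in `EuclideanSpace ℝ (Fin (n + 1))`. -/
local notation "𝕊 " n:arg => (Metric.sphere (0 : EuclideanSpace ℝ (Fin (n + 1))) 1)

attribute [local instance] fact_finrank_euclideanSpace_succ

open KnotsInBall ExitBend SegmentConj ModelTemplate

namespace BandData

namespace FlatHyp

/-- **The rail reference hypotheses of the first datum of flat hypotheses** at the reference
scale, with the shrink scale of the flat hypotheses. [folklore] -/
theorem hostHyp {A₁ B₁ K₁ : Knot} {b₁ : BandData A₁ B₁ K₁ ∅} {A₂ B₂ K₂ : Knot} {b₂ : BandData A₂ B₂ K₂ ∅}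
    {hcross₁ : b₁.band ⁻¹' sphereEquator 2 ∩ squareNhd b₁.δ = {x ∈ squareNhd b₁.δ | x 0 = 2⁻¹}}
    {hcross₂ : b₂.band ⁻¹' sphereEquator 2 ∩ squareNhd b₂.δ = {x ∈ squareNhd b₂.δ | x 0 = 2⁻¹}}
    {ε₁ r₁ A₁' ε₂ r₂ ε₁' r₁' κ : ℝ} (H : FlatHyp hcross₁ hcross₂ ε₁ r₁ A₁' ε₂ r₂ ε₁' r₁' κ) :
    b₁.HostHyp hcross₁ ε₁ r₁ A₁' κ (1 / 2) (1 / 8) :=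
  ⟨H.HU, WallRef.half_mem, by norm_num, WallRef.eighth_pos, le_rfl, H.hB, H.hAB, H.hA⟩

section HostC

variable {A B K K' : Knot} {b : BandData A B K ∅} {b' : BandData A B K' ∅}
  {c : BandData (B.map (reflectLastDiffeo 3)) (A.map (reflectLastDiffeo 3)) (K.map (reflectLastDiffeo 3)) ∅}
  {c' : BandData (B.map (reflectLastDiffeo 3)) (A.map (reflectLastDiffeo 3)) (K'.map (reflectLastDiffeo 3)) ∅}
  {hcross : b.band ⁻¹' sphereEquator 2 ∩ squareNhd b.δ = {x ∈ squareNhd b.δ | x 0 = 2⁻¹}}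
  {hcross' : b'.band ⁻¹' sphereEquator 2 ∩ squareNhd b'.δ = {x ∈ squareNhd b'.δ | x 0 = 2⁻¹}}
  {hcrossc₀ : c.band ⁻¹' sphereEquator 2 ∩ squareNhd c.δ = {x ∈ squareNhd c.δ | x 0 = 2⁻¹}}
  {hcrossc : c'.band ⁻¹' sphereEquator 2 ∩ squareNhd c'.δ = {x ∈ squareNhd c'.δ | x 0 = 2⁻¹}}
  {ε r A' εc rc ε' r' κ : ℝ} (Hb : FlatHyp hcross hcrossc₀ ε r A' εc rc ε' r' κ)
  {ε₁ r₁ A₁' ε₂ r₂ ε₁' r₁' κ₁ : ℝ} (H₁ : FlatHyp hcrossc hcross' ε₁ r₁ A₁' ε₂ r₂ ε₁' r₁' κ₁)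
  (Hball : ∀ κ', 0 < κ' → κ' ≤ κ → FlatHyp hcross hcrossc₀ ε r A' εc rc ε' r' κ')
  (H₁all : ∀ κ', 0 < κ' → κ' ≤ κ₁ → FlatHyp hcrossc hcross' ε₁ r₁ A₁' ε₂ r₂ ε₁' r₁' κ')
  (hsmall : ∀ s, ‖κ₁ • c'.frame hcrossc (template c'.depthSign s)‖ ≤ 1 / 2)
  {εf rf : ℝ} (hf : b.IsFlat hcross εf rf) (hεf : εf ≤ HostHyp.epsU) (hrf : 4 * κ < rf) (hκt : κ * tgtLip ≤ 1)

/-- **The segment data of the first conjugation** (rail reference of `b`, flip pair `(c', b')`).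
[folklore] -/
def segData₁ : SegData :=
  segData Hb.hostHyp hf hεf hrf hκt H₁.pair H₁.HU H₁.arc H₁.pairScale H₁.flat H₁.eps_le H₁.five_lt

/-- The end stage of the first conjugation on the rail reference host. [folklore] -/
theorem Psi₁_wallRef_host (x : 𝕊 1) : stageOne (segData₁ Hb H₁ hf hεf hrf hκt).Ψ (Hb.hostHyp.wallRef.host x) =
    chordH Hb.hostHyp H₁.pair H₁.HU H₁.arc H₁.pairScale H₁.flat H₁.eps_le H₁.five_lt x :=
  Psi_wallRef_host Hb.hostHyp hf hεf hrf hκt H₁.pair H₁.HU H₁.arc H₁.pairScale H₁.flat H₁.eps_le H₁.five_lt x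

/-- The linearisation of the first conjugation carries `d` to `d'` (as data of the third). [folklore] -/
theorem L₁_d : (((segData₁ Hb H₁ hf hεf hrf hκt).L : (𝔼 3) ≃L[ℝ] 𝔼 3) : (𝔼 3) →L[ℝ] 𝔼 3) (segData₃ Hb H₁ Hball H₁all hsmall).d =
    (segData₃ Hb H₁ Hball H₁all hsmall).d' :=
  (segData₁ Hb H₁ hf hεf hrf hκt).L_d

/-- The linearisation of the first conjugation has positive determinant. [folklore] -/
theorem det_L₁_pos : 0 < LinearMap.det ((((segData₁ Hb H₁ hf hεf hrf hκt).L : (𝔼 3) ≃L[ℝ] 𝔼 3) : (𝔼 3) →L[ℝ] 𝔼 3) : (𝔼 3) →ₗ[ℝ] 𝔼 3) :=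
  (segData₁ Hb H₁ hf hεf hrf hκt).det_L_pos

variable {ρ₂ R₀ lam₀ rA : ℝ} (U : (Hb.wallRef zero_mem01).UnitScale ρ₂ R₀ lam₀ rA) (hρ4 : ρ₂ ≤ 1 / 4)

/-- **The unit scale of the rail reference**: the same numbers. [folklore] -/
theorem _root_.Literature.Topology.FourManifolds.BandData.WallRef.UnitScale.toRail (U : (Hb.wallRef zero_mem01).UnitScale ρ₂ R₀ lam₀ rA) :
    Hb.hostHyp.wallRef.UnitScale ρ₂ R₀ lam₀ rA :=
  ⟨U.hl₀, U.hl₀2, U.hrA, U.hrA8, U.rA_le, U.arc_le, U.small, U.gen_le, U.lam_lt⟩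

/-- The windows of the two unit scales coincide. [folklore] -/
theorem w₁_toRail : (U.toRail Hb).w₁ hρ4 = U.w₁ hρ4 := rfl

/-- The windows of the two unit scales coincide. [folklore] -/
theorem w₂_toRail : (U.toRail Hb).w₂ hρ4 = U.w₂ hρ4 := rfl

/-- The bent knots of the rail reference and of the flip frame agree on the content of `b`. [folklore] -/
theorem bent_rail_eq_bent_flip {t : ℝ} (hc : t ∈ Icc (Hb.wallRef zero_mem01).jLo (Hb.wallRef zero_mem01).jHi) :
    Hb.hostHyp.wallRef.bent U.hl₀ U.hrA (circlePt t) = (Hb.wallRef zero_mem01).bent U.hl₀ U.hrA (circlePt t) :=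
  b.bentKnot_circlePt_congr_of_mem Hb.HU Hb.hostHyp.hW (Hb.isWallFrame zero_mem01) U.hl₀ U.hrA Hb.hB Hb.hAB hc

/-- The reference hosts of the rail reference and of the flip frame agree on the content of `b`. [folklore] -/
theorem host_rail_eq_host_flip {t : ℝ} (hc : t ∈ Icc (Hb.wallRef zero_mem01).jLo (Hb.wallRef zero_mem01).jHi) :
    Hb.hostHyp.wallRef.host (circlePt t) = (Hb.wallRef zero_mem01).host (circlePt t) :=
  Subtype.ext (by
    rw [WallRef.coe_host_circlePt, WallRef.coe_host_circlePt]
    exact b.hostLoop_congr_of_mem Hb.HU Hb.hostHyp.hW (Hb.isWallFrame zero_mem01) WallRef.half_mem (by norm_num)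
      WallRef.eighth_pos le_rfl Hb.hB Hb.hAB hc)

variable {R₁ rc₁ R₃ rc₃ : ℝ}
  (hfar₁ : ∀ t ∈ Icc b.alo (b.alo + 1), t ∉ Ioo (b.strLo Hb.HU) (b.winHi Hb.HU WallRef.half_mem) →
    chordH Hb.hostHyp H₁.pair H₁.HU H₁.arc H₁.pairScale H₁.flat H₁.eps_le H₁.five_lt (circlePt t) = northPole ∨
      R₁ ≤ ‖psiN (chordH Hb.hostHyp H₁.pair H₁.HU H₁.arc H₁.pairScale H₁.flat H₁.eps_le H₁.five_lt (circlePt t)) - chordO H₁.arc‖)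
  (hS₁ : (segData₁ Hb H₁ hf hεf hrf hκt).Small (-ρ₂) ρ₂ R₀ R₁ rc₁)
  (hfar₃ : ∀ t ∈ Icc b.alo (b.alo + 1), t ∉ Ioo (b.strLo Hb.HU) (b.winHi Hb.HU WallRef.half_mem) →
    chordH₃ Hb H₁ (circlePt t) = northPole ∨ R₃ ≤ ‖psiN (chordH₃ Hb H₁ (circlePt t)) - chordO H₁.arc‖)
  (hS₃ : (segData₃ Hb H₁ Hball H₁all hsmall).Small (-ρ₂) ρ₂ R₀ R₃ rc₃)
  (hR0 : ‖(((segData₃ Hb H₁ Hball H₁all hsmall).L : (𝔼 3) ≃L[ℝ] 𝔼 3) : (𝔼 3) →L[ℝ] 𝔼 3)‖ * R₀ ≤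
    (U.twData (segData₃ Hb H₁ Hball H₁all hsmall) hS₃ (L₁_d Hb H₁ Hball H₁all hsmall hf hεf hrf hκt)
      (det_L₁_pos Hb H₁ hf hεf hrf hκt)).R₀)

/-- **The first output** `P₁` (rail reference of `b`, unit scale `U`). [folklore] -/
def P₁ : Knot :=
  (U.toRail Hb).outOne (segData₁ Hb H₁ hf hεf hrf hκt) rfl rfl rfl rfl (Psi₁_wallRef_host Hb H₁ hf hεf hrf hκt) hρ4 hfar₁ hS₁

/-- **The twisted third output** `T₃`: the third output with the unit re-inserted by `L₁`. [folklore] -/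
def T₃ : Knot :=
  U.outTw (segData₃ Hb H₁ Hball H₁all hsmall) rfl rfl rfl rfl (Psi₃_wallRef_host Hb H₁ Hball H₁all hsmall) hρ4 hfar₃ hS₃
    (L₁_d Hb H₁ Hball H₁all hsmall hf hεf hrf hκt) (det_L₁_pos Hb H₁ hf hεf hrf hκt) hR0

/-- **The transported frame** of `FrameC.lean` for these data. [folklore] -/
def frameC₁ : ℝ → 𝔼 4 :=
  (U.toRail Hb).frameC hf hεf hrf hκt H₁.pair H₁.HU H₁.arc H₁.pairScale H₁.flat H₁.eps_le H₁.five_lt hρ4 hfar₁ hS₁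

variable (hW : c'.IsWallFrame H₁.HU.cone (frameC₁ Hb H₁ hf hεf hrf hκt U hρ4 hfar₁ hS₁))
  (hclear : c'.IsBendClear H₁.HU.cone (frameC₁ Hb H₁ hf hεf hrf hκt U hρ4 hfar₁ hS₁))

include hW hclear in
/-- **THE WALL REFERENCE OF `c'` OVER THE TRANSPORTED FRAME**: on the extended native zone of `c'`
the transported frame is the flip frame, hence the spiked piece function of `c'`. [folklore] -/
theorem wallRefC : c'.WallRef hcrossc ε₁ r₁ A₁' κ₁ (frameC₁ Hb H₁ hf hεf hrf hκt U hρ4 hfar₁ hS₁) := by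
  refine ⟨H₁.HU, hW, hclear, fun s hs ↦ ?_, H₁.hA, H₁.hB, H₁.hAB⟩
  have hκ₁ := H₁.κ_pos
  obtain ⟨c1, c2, c3⟩ := c'.core_marks
  have hl := c'.parLo_mem_core hκ₁ H₁.h7 neg_seven_halves_mem
  have hh := c'.parHi_mem_core hκ₁ H₁.h7' neg_five_quarters_mem
  have hsI : s ∈ Ico c'.alo (c'.alo + 1) := ⟨by linarith [hs.1, hl.1], by linarith [hs.2, hh.2]⟩
  -- every representative of `ĝ⁻¹ s` is off the content of `b`
  have hoff : ∀ m : ℤ, HostHyp.liftInv Hb.hostHyp H₁.HU s - m ∈ Ico b.alo (b.alo + 1) →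
      HostHyp.liftInv Hb.hostHyp H₁.HU s - m ∉ b.contentSet Hb.HU.cone.spike.κ_pos Hb.HU.cone.spike.seven_le_gapLo Hb.HU.cone.spike.seven_le_gapHi := by
    rcases WallRef.UnitScale.dichotomy Hb.hostHyp H₁.HU hsI with h | ⟨-, hc⟩
    · exact h
    · exfalso
      obtain ⟨hcore, hα⟩ := WallRef.UnitScale.chordLift_mem_of_mem Hb.hostHyp H₁.HU hc
      obtain ⟨-, hgt, -⟩ := WallRef.UnitScale.chordZone_marks H₁.HU hcore hα
      rw [HostHyp.chordLift_liftInv] at hgt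
      exact absurd hs.2 (not_le.2 hgt)
  rw [frameC₁, (U.toRail Hb).frameC_eq_periodise hf hεf hrf hκt H₁.pair H₁.HU H₁.arc H₁.pairScale H₁.flat H₁.eps_le H₁.five_lt hρ4 hfar₁ hS₁ hoff,
    periodise_eq_self c'.alo _ hsI]
  exact H₁.frame_eq_spikePiece 1 hs

/-- **THE HOST OF `c'` OVER THE TRANSPORTED FRAME** (reference scale). [folklore] -/
def hostC : Knot := (wallRefC Hb H₁ hf hεf hrf hκt U hρ4 hfar₁ hS₁ hW hclear).host

/-! ### Pointwise comparison on the content of `b` -/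

/-- **On the content of `b` the first output and the twisted third output agree.** [folklore] -/
theorem P₁_eq_T₃_of_mem {t : ℝ} (hc : t ∈ Icc (Hb.wallRef zero_mem01).jLo (Hb.wallRef zero_mem01).jHi) :
    P₁ Hb H₁ hf hεf hrf hκt U hρ4 hfar₁ hS₁ (circlePt t) = T₃ Hb H₁ Hball H₁all hsmall hf hεf hrf hκt U hρ4 hfar₃ hS₃ hR0 (circlePt t) := by
  set D₁ := segData₁ Hb H₁ hf hεf hrf hκt with hD₁
  set D₃ := segData₃ Hb H₁ Hball H₁all hsmall with hD₃
  set W₁ := Hb.hostHyp.wallRef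
  have W₃ := Hb.wallRef zero_mem01
  obtain ⟨z1, z2, z3, z4, z5, z6⟩ := (Hb.wallRef zero_mem01).content_marks
  obtain ⟨m1, m2, m3, m4, m5, m6⟩ := U.window_marks hρ4
  have hjl := b.juncLo_mem_core Hb.κ_pos Hb.h7
  have hjh := b.juncHi_mem_core Hb.κ_pos Hb.h7'
  obtain ⟨c1, c2, c3⟩ := b.core_marks
  have hc' : (Hb.wallRef zero_mem01).jLo ≤ t ∧ t ≤ (Hb.wallRef zero_mem01).jHi := hc
  have hI : t ∈ Ico b.alo (b.alo + 1) :=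
    ⟨by linarith [hjl.1, hc'.1, show (Hb.wallRef zero_mem01).jLo = b.juncLo Hb.κ_pos Hb.h7 from rfl],
      by linarith [hjh.2, hc'.2, show (Hb.wallRef zero_mem01).jHi = b.juncHi Hb.κ_pos Hb.h7' from rfl]⟩
  by_cases hw : t ∈ Icc (U.w₁ hρ4) (U.w₂ hρ4)
  · -- on the window: the same unit point re-inserted by the same affine map
    apply Subtype.ext
    rw [P₁, (U.toRail Hb).coe_outOne_circlePt_of_mem D₁ rfl rfl rfl rfl (Psi₁_wallRef_host Hb H₁ hf hεf hrf hκt) hρ4 hfar₁ hS₁ hw, T₃,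
      U.coe_outTw_circlePt_of_mem D₃ rfl rfl rfl rfl (Psi₃_wallRef_host Hb H₁ Hball H₁all hsmall) hρ4 hfar₃ hS₃ (L₁_d Hb H₁ Hball H₁all hsmall hf hεf hrf hκt) (det_L₁_pos Hb H₁ hf hεf hrf hκt) hR0 hw,
      bent_rail_eq_bent_flip Hb U hc]
    rfl
  · -- off the window: segment points or spiral points, carried to the same chord points
    rw [P₁, (U.toRail Hb).outOne_circlePt_of_not_mem D₁ rfl rfl rfl rfl (Psi₁_wallRef_host Hb H₁ hf hεf hrf hκt) hρ4 hfar₁ hS₁ hI hw, T₃,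
      U.outTw_circlePt_of_not_mem D₃ rfl rfl rfl rfl (Psi₃_wallRef_host Hb H₁ Hball H₁all hsmall) hρ4 hfar₃ hS₃ (L₁_d Hb H₁ Hball H₁all hsmall hf hεf hrf hκt) (det_L₁_pos Hb H₁ hf hεf hrf hκt) hR0 hI hw,
      U.outOne_circlePt_of_not_mem D₃ rfl rfl rfl rfl (Psi₃_wallRef_host Hb H₁ Hball H₁all hsmall) hρ4 hfar₃ hS₃ hI hw,
      bent_rail_eq_bent_flip Hb U hc]
    rcases U.content_off_cases hρ4 hc hw with ⟨ρ, hρ, he⟩ | ⟨t', ht', he⟩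
    · rw [he]
      have e1 := D₁.seg ρ ⟨by rw [show D₁.ρlo = -1 from rfl]; exact hρ.1, by rw [show D₁.ρhi = 1 / 2 from rfl]; exact hρ.2⟩
      have e3 := D₃.seg ρ ⟨by rw [show D₃.ρlo = -1 from rfl]; exact hρ.1, by rw [show D₃.ρhi = 1 / 2 from rfl]; exact hρ.2⟩
      exact e1.trans e3.symm
    · rw [he]
      have hwh := b.winHi_mem_core Hb.HU WallRef.half_mem
      have hc2 : t' ∈ Icc (Hb.wallRef zero_mem01).jLo (Hb.wallRef zero_mem01).jHi :=
        ⟨by linarith [ht'.1, show (Hb.wallRef zero_mem01).jLo = b.juncLo Hb.κ_pos Hb.h7 from rfl, z5, hwh.1], ht'.2⟩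
      have hstr : t' ∈ Icc (b.strLo Hb.HU) (b.strHi Hb.HU) := by
        obtain ⟨s1, s2, s3, s3', s4, s5⟩ := b.str_marks Hb.HU WallRef.half_mem
        constructor
        · linarith [ht'.1, b.winLo_lt_collarLo Hb.HU WallRef.half_mem (by norm_num), b.collarLo_lt_collarHi Hb.HU WallRef.half_mem (by norm_num),
            b.collarHi_lt_winHi Hb.HU WallRef.half_mem (by norm_num)]
        · -- `jHi ≤ strHi`
          have hκ := Hb.κ_pos
          obtain ⟨hjh', hjhv⟩ := b.juncHi_spec hκ Hb.h7'
          have : b.juncHi hκ Hb.h7' ≤ b.strHi Hb.HU := by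
            by_contra hlt; push Not at hlt
            have := (b.strictAntiOn_alphaHi hκ) (b.parHi_mem_core hκ Hb.h7' quarter_mem7) ⟨hjh'.1, by linarith [hjh'.2, b.epsHi_bounds.1]⟩ hlt
            rw [hjhv, b.alphaHi_parHi hκ Hb.h7' quarter_mem7] at this
            norm_num at this
          exact ht'.2.trans this
      rw [← host_rail_eq_host_flip Hb hc2, show stageOne D₁.Ψ (Hb.hostHyp.wallRef.host (circlePt t')) =
        chordH Hb.hostHyp H₁.pair H₁.HU H₁.arc H₁.pairScale H₁.flat H₁.eps_le H₁.five_lt (circlePt t') from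
        Psi₁_wallRef_host Hb H₁ hf hεf hrf hκt _, chordH,
        b.chordHost_circlePt_of_mem Hb.HU WallRef.half_mem _ H₁.HU H₁.arc H₁.pair H₁.pairScale H₁.flat H₁.eps_le H₁.five_lt _ _ _ _ hstr,
        host_rail_eq_host_flip Hb hc2, show stageOne D₃.Ψ ((Hb.wallRef zero_mem01).host (circlePt t')) = chordH₃ Hb H₁ (circlePt t') from
        Psi₃_wallRef_host Hb H₁ Hball H₁all hsmall _, chordH₃, b.chordHostZ_circlePt_of_mem Hb.HU WallRef.half_mem _ H₁ hstr]

/-! ### Pointwise comparison off the content of `b` -/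

/-- **Off the content of `b` the host over the transported frame at `ĝ t` is the host of the flip
frame of `(c', b')` at `u = 1`.** [folklore] -/
theorem hostC_circlePt_chordLift_of_not_mem {t : ℝ} (ht : t ∈ Ico b.alo (b.alo + 1))
    (hts : t ∉ Icc (Hb.wallRef zero_mem01).jLo (Hb.wallRef zero_mem01).jHi) :
    hostC Hb H₁ hf hεf hrf hκt U hρ4 hfar₁ hS₁ hW hclear (circlePt (b.chordLift Hb.HU WallRef.half_mem (by norm_num) H₁.HU t)) =
      H₁.host one_mem01 (circlePt (b.chordLift Hb.HU WallRef.half_mem (by norm_num) H₁.HU t)) := by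
  set WC := wallRefC Hb H₁ hf hεf hrf hκt U hρ4 hfar₁ hS₁ hW hclear
  set τ := b.chordLift Hb.HU WallRef.half_mem (by norm_num) H₁.HU t with hτ
  obtain ⟨m, hm⟩ := exists_toIcoMod_one_eq c'.alo τ
  have hτ' : τ - m ∈ Ico c'.alo (c'.alo + 1) := by rw [← hm]; exact toIcoMod_one_mem c'.alo τ
  have e1 : circlePt τ = circlePt (τ - m) := by
    rw [show τ - (m : ℝ) = τ + ((-m : ℤ) : ℝ) by push_cast; ring, circlePt_add_int]
  rw [e1, ← H₁.wallRef_host one_mem01, hostC]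
  apply Subtype.ext
  rw [WallRef.coe_host_circlePt, WallRef.coe_host_circlePt]
  by_cases hc : τ - m ∈ Icc (H₁.wallRef one_mem01).jLo (H₁.wallRef one_mem01).jHi
  · -- content of `c'`: the hosts of two wall frames agree
    exact c'.hostLoop_congr_of_mem H₁.HU hW (H₁.isWallFrame one_mem01) WallRef.half_mem (by norm_num) WallRef.eighth_pos le_rfl H₁.hB H₁.hAB hc
  · -- off the content of `c'`: the frames, and the transported frame is the flip frame there
    rw [WC.hostLoop_of_not_mem hτ' hc, (H₁.wallRef one_mem01).hostLoop_of_not_mem hτ' hc]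
    have hoff : ∀ m' : ℤ, HostHyp.liftInv Hb.hostHyp H₁.HU (τ - m) - m' ∈ Ico b.alo (b.alo + 1) →
        HostHyp.liftInv Hb.hostHyp H₁.HU (τ - m) - m' ∉ b.contentSet Hb.HU.cone.spike.κ_pos Hb.HU.cone.spike.seven_le_gapLo Hb.HU.cone.spike.seven_le_gapHi := by
      intro m' hm' hcm
      have e : HostHyp.liftInv Hb.hostHyp H₁.HU (τ - m) = t - m := by
        rw [show τ - (m : ℝ) = τ + ((-m : ℤ) : ℝ) by push_cast; ring, (HostHyp.isLift_liftInv Hb.hostHyp H₁.HU).add_int, hτ,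
          HostHyp.liftInv_chordLift]
        push_cast; ring
      rw [e] at hm' hcm
      have h5 : ((m + m' : ℤ) : ℝ) < 1 := by push_cast; linarith [hm'.1, ht.2]
      have h6 : (-1 : ℝ) < ((m + m' : ℤ) : ℝ) := by push_cast; linarith [hm'.2, ht.1]
      have h5' : m + m' < 1 := by exact_mod_cast h5
      have h6' : -1 < m + m' := by exact_mod_cast h6
      have h0 : m + m' = 0 := by omega
      have : t - m - m' = t := by
        have : (m : ℝ) + m' = 0 := by exact_mod_cast h0
        linarith
      rw [this] at hcm
      exact hts hcm
    rw [frameC₁, (U.toRail Hb).frameC_eq_periodise hf hεf hrf hκt H₁.pair H₁.HU H₁.arc H₁.pairScale H₁.flat H₁.eps_le H₁.five_lt hρ4 hfar₁ hS₁ hoff,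
      periodise_eq_self c'.alo _ hτ']
    rfl

/-- **Off the content of `b` the reflected twisted third output at `t` is the host of the flip
frame of `(c', b')` at `u = 1`, at `ĝ t`.** [folklore] -/
theorem T₃_of_not_mem {t : ℝ} (ht : t ∈ Ico b.alo (b.alo + 1))
    (hts : t ∉ Icc (Hb.wallRef zero_mem01).jLo (Hb.wallRef zero_mem01).jHi) :
    T₃ Hb H₁ Hball H₁all hsmall hf hεf hrf hκt U hρ4 hfar₃ hS₃ hR0 (circlePt t) =
      reflectLast 3 (H₁.host one_mem01 (circlePt (b.chordLift Hb.HU WallRef.half_mem (by norm_num) H₁.HU t))) := by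
  obtain ⟨m1, m2, m3, m4, m5, m6⟩ := U.window_marks hρ4
  obtain ⟨z1, z2, z3, z4, z5, z6⟩ := (Hb.wallRef zero_mem01).content_marks
  have hw : t ∉ Icc (U.w₁ hρ4) (U.w₂ hρ4) := fun h ↦ hts
    ⟨by linarith [h.1, show (Hb.wallRef zero_mem01).jLo = b.juncLo Hb.κ_pos Hb.h7 from rfl],
      by linarith [h.2, show (Hb.wallRef zero_mem01).jHi = b.juncHi Hb.κ_pos Hb.h7' from rfl]⟩
  rw [T₃, U.outTw_circlePt_of_not_mem (segData₃ Hb H₁ Hball H₁all hsmall) rfl rfl rfl rfl (Psi₃_wallRef_host Hb H₁ Hball H₁all hsmall) hρ4 hfar₃ hS₃ (L₁_d Hb H₁ Hball H₁all hsmall hf hεf hrf hκt) (det_L₁_pos Hb H₁ hf hεf hrf hκt) hR0 ht hw,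
    U.outOne_circlePt_of_not_mem (segData₃ Hb H₁ Hball H₁all hsmall) rfl rfl rfl rfl (Psi₃_wallRef_host Hb H₁ Hball H₁all hsmall) hρ4 hfar₃ hS₃ ht hw,
    (Hb.wallRef zero_mem01).bent_of_not_mem U.hl₀ U.hrA ht hts]
  have e1 : stageOne (segData₃ Hb H₁ Hball H₁all hsmall).Ψ ((Hb.wallRef zero_mem01).host (circlePt t)) = chordH₃ Hb H₁ (circlePt t) :=
    Psi₃_wallRef_host Hb H₁ Hball H₁all hsmall _
  rw [e1, chordH₃, b.chordHostZ_circlePt, hostR, SphereEmbedding.map_apply, coe_reflectLastDiffeo]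

/-- **Off the content of `b`**: `hostC (circlePt (ĝ t)) = R (T₃ (circlePt t))`. [folklore] -/
theorem hostC_circlePt_chordLift_of_not_mem' {t : ℝ} (ht : t ∈ Ico b.alo (b.alo + 1))
    (hts : t ∉ Icc (Hb.wallRef zero_mem01).jLo (Hb.wallRef zero_mem01).jHi) :
    hostC Hb H₁ hf hεf hrf hκt U hρ4 hfar₁ hS₁ hW hclear (circlePt (b.chordLift Hb.HU WallRef.half_mem (by norm_num) H₁.HU t)) =
      reflectLast 3 (T₃ Hb H₁ Hball H₁all hsmall hf hεf hrf hκt U hρ4 hfar₃ hS₃ hR0 (circlePt t)) := by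
  rw [hostC_circlePt_chordLift_of_not_mem Hb H₁ hf hεf hrf hκt U hρ4 hfar₁ hS₁ hW hclear ht hts,
    T₃_of_not_mem Hb H₁ Hball H₁all hsmall hf hεf hrf hκt U hρ4 hfar₃ hS₃ hR0 ht hts, reflectLast_reflectLast]

/-- **On the content of `b`**: `hostC (circlePt (ĝ t)) = R (T₃ (circlePt t))`. [folklore] -/
theorem hostC_circlePt_chordLift_of_mem {t : ℝ} (hc : t ∈ Icc (Hb.wallRef zero_mem01).jLo (Hb.wallRef zero_mem01).jHi) :
    hostC Hb H₁ hf hεf hrf hκt U hρ4 hfar₁ hS₁ hW hclear (circlePt (b.chordLift Hb.HU WallRef.half_mem (by norm_num) H₁.HU t)) =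
      reflectLast 3 (T₃ Hb H₁ Hball H₁all hsmall hf hεf hrf hκt U hρ4 hfar₃ hS₃ hR0 (circlePt t)) := by
  set WC := wallRefC Hb H₁ hf hεf hrf hκt U hρ4 hfar₁ hS₁ hW hclear
  have hc' : t ∈ b.contentSet Hb.HU.cone.spike.κ_pos Hb.HU.cone.spike.seven_le_gapLo Hb.HU.cone.spike.seven_le_gapHi := hc
  obtain ⟨hcore, hα⟩ := WallRef.UnitScale.chordLift_mem_of_mem Hb.hostHyp H₁.HU hc'
  obtain ⟨hIoo, -, hnc⟩ := WallRef.UnitScale.chordZone_marks H₁.HU hcore hα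
  set τ := b.chordLift Hb.HU WallRef.half_mem (by norm_num) H₁.HU t with hτ
  have hτI : τ ∈ Ico c'.alo (c'.alo + 1) := ⟨hIoo.1.le, hIoo.2⟩
  rw [← P₁_eq_T₃_of_mem Hb H₁ Hball H₁all hsmall hf hεf hrf hκt U hρ4 hfar₁ hS₁ hfar₃ hS₃ hR0 hc]
  apply Subtype.ext
  rw [hostC, WallRef.coe_host_circlePt, WC.hostLoop_of_not_mem hτI hnc]
  show frameC₁ Hb H₁ hf hεf hrf hκt U hρ4 hfar₁ hS₁ τ = _
  rw [frameC₁, hτ]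
  exact (U.toRail Hb).frameC_chordLift hf hεf hrf hκt H₁.pair H₁.HU H₁.arc H₁.pairScale H₁.flat H₁.eps_le H₁.five_lt hρ4 hfar₁ hS₁ t

/-- **`hostC (circlePt (ĝ t)) = R (T₃ (circlePt t))` FOR EVERY PARAMETER `t`.** [folklore] -/
theorem hostC_circlePt_chordLift (t : ℝ) :
    hostC Hb H₁ hf hεf hrf hκt U hρ4 hfar₁ hS₁ hW hclear (circlePt (b.chordLift Hb.HU WallRef.half_mem (by norm_num) H₁.HU t)) =
      reflectLast 3 (T₃ Hb H₁ Hball H₁all hsmall hf hεf hrf hκt U hρ4 hfar₃ hS₃ hR0 (circlePt t)) := by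
  obtain ⟨m, hm⟩ := exists_toIcoMod_one_eq b.alo t
  have ht' : t - m ∈ Ico b.alo (b.alo + 1) := by rw [← hm]; exact toIcoMod_one_mem b.alo t
  have e1 : circlePt t = circlePt (t - m) := by
    rw [show t - (m : ℝ) = t + ((-m : ℤ) : ℝ) by push_cast; ring, circlePt_add_int]
  have e2 : circlePt (b.chordLift Hb.HU WallRef.half_mem (by norm_num) H₁.HU t) =
      circlePt (b.chordLift Hb.HU WallRef.half_mem (by norm_num) H₁.HU (t - m)) := by
    rw [show t - (m : ℝ) = t + ((-m : ℤ) : ℝ) by push_cast; ring, (b.isLift_chordLift Hb.HU WallRef.half_mem _ H₁.HU).add_int,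
      circlePt_add_int]
  rw [e1, e2]
  by_cases hc : t - m ∈ Icc (Hb.wallRef zero_mem01).jLo (Hb.wallRef zero_mem01).jHi
  · exact hostC_circlePt_chordLift_of_mem Hb H₁ Hball H₁all hsmall hf hεf hrf hκt U hρ4 hfar₁ hS₁ hfar₃ hS₃ hR0 hW hclear hc
  · exact hostC_circlePt_chordLift_of_not_mem' Hb H₁ Hball H₁all hsmall hf hεf hrf hκt U hρ4 hfar₁ hS₁ hfar₃ hS₃ hR0 hW hclear ht' hc

/-! ### The host over the transported frame as a reparametrised reflected output -/

/-- **The reflected twisted third output** `R ∘ T₃`. [folklore] -/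
def T₃R : Knot := (T₃ Hb H₁ Hball H₁all hsmall hf hεf hrf hκt U hρ4 hfar₃ hS₃ hR0).map (reflectLastDiffeo 3)

/-- The loop of `R ∘ T₃` through the inverse chord lift. [folklore] -/
def hostCLoop : ℝ → 𝔼 4 :=
  Knot.curve (T₃R Hb H₁ Hball H₁all hsmall hf hεf hrf hκt U hρ4 hfar₃ hS₃ hR0) ∘ HostHyp.liftInv Hb.hostHyp H₁.HU

/-- That loop is a regular loop. [folklore] -/
theorem isRegularLoop_hostCLoop : IsRegularLoop (hostCLoop Hb H₁ Hball H₁all hsmall hf hεf hrf hκt U hρ4 hfar₃ hS₃ hR0) :=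
  (T₃R Hb H₁ Hball H₁all hsmall hf hεf hrf hκt U hρ4 hfar₃ hS₃ hR0).isRegularLoop_curve.comp_lift (HostHyp.isLift_liftInv Hb.hostHyp H₁.HU)

/-- That loop is simple. [folklore] -/
theorem simple_hostCLoop : ∀ s t, hostCLoop Hb H₁ Hball H₁all hsmall hf hεf hrf hκt U hρ4 hfar₃ hS₃ hR0 s =
    hostCLoop Hb H₁ Hball H₁all hsmall hf hεf hrf hκt U hρ4 hfar₃ hS₃ hR0 t → ∃ m : ℤ, t - s = m :=
  IsRegularLoop.simple_comp_lift (HostHyp.isLift_liftInv Hb.hostHyp H₁.HU) (T₃R Hb H₁ Hball H₁all hsmall hf hεf hrf hκt U hρ4 hfar₃ hS₃ hR0).simple_curve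

/-- **The reparametrised reflected output** `Q`. [folklore] -/
def hostQ : Knot :=
  (isRegularLoop_hostCLoop Hb H₁ Hball H₁all hsmall hf hεf hrf hκt U hρ4 hfar₃ hS₃ hR0).toKnot
    (simple_hostCLoop Hb H₁ Hball H₁all hsmall hf hεf hrf hκt U hρ4 hfar₃ hS₃ hR0)

/-- `Q` is isotopic to `R ∘ T₃`. [cite: HirschDT1976, Ch. 8, Thm. 8.1.3 (p. 180)] -/
theorem isIsotopic_hostQ_T₃R : (hostQ Hb H₁ Hball H₁all hsmall hf hεf hrf hκt U hρ4 hfar₃ hS₃ hR0).IsIsotopic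
    (T₃R Hb H₁ Hball H₁all hsmall hf hεf hrf hκt U hρ4 hfar₃ hS₃ hR0) := by
  have h := (T₃R Hb H₁ Hball H₁all hsmall hf hεf hrf hκt U hρ4 hfar₃ hS₃ hR0).isRegularLoop_curve.isIsotopic_toKnot_comp_lift
    (HostHyp.isLift_liftInv Hb.hostHyp H₁.HU) (T₃R Hb H₁ Hball H₁all hsmall hf hεf hrf hκt U hρ4 hfar₃ hS₃ hR0).simple_curve
  rw [Knot.toKnot_curve] at h
  exact h

/-- **THE HOST OVER THE TRANSPORTED FRAME IS THE REPARAMETRISED REFLECTED OUTPUT**: `hostC = Q`. [folklore] -/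
theorem hostC_eq_hostQ : hostC Hb H₁ hf hεf hrf hκt U hρ4 hfar₁ hS₁ hW hclear = hostQ Hb H₁ Hball H₁all hsmall hf hεf hrf hκt U hρ4 hfar₃ hS₃ hR0 := by
  set H := hostC Hb H₁ hf hεf hrf hκt U hρ4 hfar₁ hS₁ hW hclear
  apply DFunLike.coe_injective
  funext u
  obtain ⟨τ, -, hτu⟩ := H.exists_mem_Ico_apply_circlePt_eq c'.alo (x := H u) ⟨u, rfl⟩
  have hu : circlePt τ = u := H.injective hτu
  rw [← hu]
  apply Subtype.ext
  rw [hostQ, (isRegularLoop_hostCLoop Hb H₁ Hball H₁all hsmall hf hεf hrf hκt U hρ4 hfar₃ hS₃ hR0).coe_toKnot_circlePt, hostCLoop, comp_apply,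
    Knot.curve_apply, T₃R, SphereEmbedding.map_apply, coe_reflectLastDiffeo]
  have e := hostC_circlePt_chordLift Hb H₁ Hball H₁all hsmall hf hεf hrf hκt U hρ4 hfar₁ hS₁ hfar₃ hS₃ hR0 hW hclear (HostHyp.liftInv Hb.hostHyp H₁.HU τ)
  have e2 : b.chordLift Hb.HU WallRef.half_mem (by norm_num) H₁.HU (HostHyp.liftInv Hb.hostHyp H₁.HU τ) = τ := HostHyp.chordLift_liftInv Hb.hostHyp H₁.HU τ
  rw [e2] at e
  rw [e]

include Hball H₁all hsmall hfar₃ hS₃ hR0 in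
/-- **THE HOST OF `c'` OVER THE TRANSPORTED FRAME IS ISOTOPIC TO `R ∘ B = A_{c'}`.**
[cite: HirschDT1976, Ch. 8 §1, Thm. 1.3] -/
theorem isIsotopic_hostC (hBA : B = (B.map (reflectLastDiffeo 3)).map (reflectLastDiffeo 3)) :
    (hostC Hb H₁ hf hεf hrf hκt U hρ4 hfar₁ hS₁ hW hclear).IsIsotopic (B.map (reflectLastDiffeo 3)) := by
  rw [hostC_eq_hostQ Hb H₁ Hball H₁all hsmall hf hεf hrf hκt U hρ4 hfar₁ hS₁ hfar₃ hS₃ hR0 hW hclear]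
  refine IsAmbientIsotopic.trans_holds (isIsotopic_hostQ_T₃R Hb H₁ Hball H₁all hsmall hf hεf hrf hκt U hρ4 hfar₃ hS₃ hR0) ?_
  rw [T₃R, T₃]
  refine SphereEmbedding.IsIsotopic.map_congr ?_ _
  exact IsAmbientIsotopic.trans_holds
    (IsAmbientIsotopic.symm_holds (U.isIsotopic_outOne_outTw (segData₃ Hb H₁ Hball H₁all hsmall) rfl rfl rfl rfl (Psi₃_wallRef_host Hb H₁ Hball H₁all hsmall) hρ4 hfar₃ hS₃ (L₁_d Hb H₁ Hball H₁all hsmall hf hεf hrf hκt) (det_L₁_pos Hb H₁ hf hεf hrf hκt) hR0))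
    (isIsotopic_outThree_B Hb H₁ Hball H₁all hsmall U hρ4 hfar₃ hS₃ hBA)


end HostC

end FlatHyp

end BandData

end Literature.Topology.FourManifolds
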